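import Summits.KontsevichZagierPeriods.KontsevichZagierPeriods.Theses.IsogenyCertificates
import Summits.KontsevichZagierPeriods.KontsevichZagierPeriods.Theorems.XMapKernel.Negative.Core
import Summits.KontsevichZagierPeriods.KontsevichZagierPeriods.Theorems.IsogenyCertificatesKernelFormGlue
import Summits.KontsevichZagierPeriods.KontsevichZagierPeriods.Theorems.IsogenyCertificatesXMapPeriodTransfer
import Summits.KontsevichZagierPeriods.KontsevichZagierPeriods.Theorems.MzvKernelInKZ.Negative.ScalingDivision
import Literature.NumberTheory.Transcendental.KZRelationsLE
import Literature.NumberTheory.Transcendental.KZProduct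

/-!
# Strategist sketch — crux `XMapKernel` (stmt-KontsevichZagierPeriods-10663), typed STRATEGY CENSUS

Companion of `STRATEGY-CENSUS.md` (crux-strategist seat, 2026-08-16). Every statement the census
relies on is either PROVED here (no `sorry` anywhere in this file) or an open constant of the tree
cited by name. Sections follow the census headings.

* §0  The crux is the summit UNCONDITIONALLY (`crux_iff_summit`): Disproof F1
  (`Negative.Core.iff_summit_of_transfer`) composed with the now-PROVED sibling crux
  `XMapPeriodTransfer` (`XMapPeriodTransferCells.XMapPeriodTransfer_of`, item 10665 closed).
* §1  SHAPE OF EVERY LINE (`crux_iff_cell_and_reduces`): for ANY subgroup `S` of `FormalRep`,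
  `XMapKernel ↔ CellKernel S ∧ ReducesTo S`, and given the cell the reduction `ReducesTo S` is
  equivalent to the crux (`reducesTo_iff_crux_of_cell`). The three registered lines are the cases
  `S` = real-period sector, `S` = (ω,η)-egg sector; the transfer attempt of the census is
  `S = KZ.formalRepLE 1` (1-periods, Huber–Wüstholz). In every case the stub `K = ReducesTo S` is the
  crux itself given the cell: no sector choice moves the crux.
* §2  STRENGTHEN: the budgeted kernel `BudgetedKernel` (DimensionBudget shape, typed over
  `KZ.formalRepLE` / `KZ.relationsLE`) implies the crux (`crux_of_budgetedKernel`); it is at least as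
  hard and offers no inductive step (census §Strengthen).
* §3  DECOMPOSITION: the two typed splits in print — π-localisation (Ayoub 2014 Cor. 32 shape,
  `KZ.PiLocalKernel ∧ KZ.PiCancellation`, route AyoubSpecialisation) and torsion (`RationalKernel`,
  route CoactionDevissage) — both glue to the crux (`crux_of_piLocal`, `crux_of_rationalKernel`) and
  are IMPLIED by it (`piLocal_and_piCancellation_of_crux`, `rationalKernel_of_crux`); with integer
  division landed (`MzvKernelInKZ.Negative.mem_relations_of_nsmul_mem`) the torsion split is
  degenerate (`rationalKernel_iff_crux`), and the π-local piece is Conjecture 1 for the localised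
  ring (GPC-complete by the catalogued barrier).
* §4  NEGATION: by §0 every counterexample is a refutation of the formalised summit
  (`not_summit_of_not_crux`); the separating-invariant template of Negative/Core §2 is complete.
-/

noncomputable section

-- crux work file: the prescribed namespace repeats the summit name; silence only that linter.
set_option linter.dupNamespace false

namespace Summit.KontsevichZagierPeriods.KontsevichZagierPeriods.Cruxes.XMapKernel.StrategistSketch

open Literature.NumberTheory.Transcendental
open Summit.KontsevichZagierPeriods.KontsevichZagierPeriods.Theses.IsogenyCertificates
open Summit.KontsevichZagierPeriods.XMapKernel.Negative

/-! ## §0 The crux is the summit, unconditionally -/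

/-- The sibling crux is a theorem of the tree (item 10665, closed). -/
theorem transfer_holds : XMapPeriodTransfer :=
  Summit.KontsevichZagierPeriods.IsogenyCertificates.XMapPeriodTransferCells.XMapPeriodTransfer_of

/-- **F1 made unconditional.** `XMapKernel ↔ KontsevichZagierPeriods`. -/
theorem crux_iff_summit : XMapKernel ↔ _root_.KontsevichZagierPeriods :=
  iff_summit_of_transfer transfer_holds

/-- `XMapKernel ↔ KZKernelConjecture` (kernel form of Conjecture 1), unconditionally. -/
theorem crux_iff_kernelForm :
    XMapKernel ↔ ∀ c : KZ.FormalRep, KZ.eval c = 0 → c ∈ KZ.relations :=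
  iff_kzKernelConjecture_of_transfer transfer_holds

/-- The landed glue, kernel form ⇒ crux (route support item KernelFormGlue, 14088). -/
theorem crux_of_kernelForm (hK : ∀ c : KZ.FormalRep, KZ.eval c = 0 → c ∈ KZ.relations) : XMapKernel :=
  Summit.KontsevichZagierPeriods.IsogenyCertificates.KernelFormGlue.KernelFormGlue_proof hK

/-- §4 in one line: a counterexample to the crux refutes the formalised period conjecture. -/
theorem not_summit_of_not_crux (h : ¬ XMapKernel) : ¬ _root_.KontsevichZagierPeriods :=
  not_summit_of_not h

/-! ## §1 The shape of every line: cell + reduction, and the reduction IS the crux -/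

/-- The kernel conjecture restricted to a sector `S` (a "cell"). -/
def CellKernel (S : AddSubgroup KZ.FormalRep) : Prop :=
  ∀ c ∈ S, KZ.eval c = 0 → c ∈ AddSubgroup.closure gens

/-- Reduction to the sector `S` modulo the enlarged move group (the stub `K` of every line). -/
def ReducesTo (S : AddSubgroup KZ.FormalRep) : Prop :=
  ∀ c : KZ.FormalRep, KZ.eval c = 0 → ∃ c' ∈ S, c - c' ∈ AddSubgroup.closure gens

/-- Cell + reduction ⇒ crux (the composition `XMapKernel_of` of every registered skeleton). -/
theorem crux_of_cell_of_reduces (S : AddSubgroup KZ.FormalRep) (hC : CellKernel S) (hR : ReducesTo S) :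
    XMapKernel := by
  rw [crux_iff]
  intro c hc
  obtain ⟨c', hc'S, hcc'⟩ := hR c hc
  have hdiff : KZ.eval (c - c') = 0 := AddMonoidHom.mem_ker.1 (closure_gens_le_ker_eval hcc')
  have hc'0 : KZ.eval c' = 0 := by
    rw [map_sub, hc, zero_sub, neg_eq_zero] at hdiff
    exact hdiff
  have hsum : c = (c - c') + c' := by abel
  rw [hsum]
  exact add_mem hcc' (hC c' hc'S hc'0)

/-- The crux implies every cell … -/
theorem cell_of_crux (S : AddSubgroup KZ.FormalRep) (h : XMapKernel) : CellKernel S :=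
  fun c _ hc => (crux_iff.1 h) c hc

/-- … and every reduction (take `c' = 0`). -/
theorem reduces_of_crux (S : AddSubgroup KZ.FormalRep) (h : XMapKernel) : ReducesTo S :=
  fun c hc => ⟨0, zero_mem S, by simpa using (crux_iff.1 h) c hc⟩

/-- **Shape theorem.** For every sector `S`: `XMapKernel ↔ CellKernel S ∧ ReducesTo S`. -/
theorem crux_iff_cell_and_reduces (S : AddSubgroup KZ.FormalRep) :
    XMapKernel ↔ CellKernel S ∧ ReducesTo S :=
  ⟨fun h => ⟨cell_of_crux S h, reduces_of_crux S h⟩, fun h => crux_of_cell_of_reduces S h.1 h.2⟩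

/-- **Given the cell, the reduction stub IS the crux** (hence, by §0, the summit): no choice of
sector makes `K` smaller than Conjecture 1 relative to that sector. -/
theorem reducesTo_iff_crux_of_cell (S : AddSubgroup KZ.FormalRep) (hC : CellKernel S) :
    ReducesTo S ↔ XMapKernel :=
  ⟨crux_of_cell_of_reduces S hC, reduces_of_crux S⟩

/-- And given the cell, `K` is the SUMMIT. -/
theorem reducesTo_iff_summit_of_cell (S : AddSubgroup KZ.FormalRep) (hC : CellKernel S) :
    ReducesTo S ↔ _root_.KontsevichZagierPeriods :=
  (reducesTo_iff_crux_of_cell S hC).trans crux_iff_summit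

/-- TRANSFER attempt of the census (1-motives / Huber–Wüstholz 2022 Thm 13.3): the sector of
1-periods is `KZ.formalRepLE 1` (combinations supported in dimension ≤ 1). Its cell is the typed
statement below; it is a RESTRICTION of the crux (so true if the crux is) and its remainder
`ReducesTo (KZ.formalRepLE 1)` is the crux again by `reducesTo_iff_crux_of_cell`. -/
def OnePeriodCell : Prop := CellKernel (KZ.formalRepLE 1)

/-- The 1-period cell is implied by the crux. -/
theorem onePeriodCell_of_crux (h : XMapKernel) : OnePeriodCell := cell_of_crux _ h

/-- The 1-period transfer line would be `OnePeriodCell → ReducesTo (formalRepLE 1) → XMapKernel`. -/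
theorem crux_of_onePeriodCell (hC : OnePeriodCell) (hR : ReducesTo (KZ.formalRepLE 1)) : XMapKernel :=
  crux_of_cell_of_reduces _ hC hR

/-! ## §2 Strengthen: the budgeted kernel (DimensionBudget shape) -/

/-- **S⁺ (budgeted kernel).** Every kernel element supported in dimension `≤ d` is a relation
INSIDE dimension `≤ d + 1` (`KZ.relationsLE`). Stronger than Conjecture 1 in kernel form. -/
def BudgetedKernel : Prop :=
  ∀ d : ℕ, ∀ c ∈ KZ.formalRepLE d, KZ.eval c = 0 → c ∈ KZ.relationsLE (d + 1)

/-- Every formal combination is supported in some dimension (directed union). -/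
theorem exists_mem_formalRepLE (c : KZ.FormalRep) : ∃ d, c ∈ KZ.formalRepLE d := by
  have hdir : Directed (· ≤ ·) KZ.formalRepLE :=
    Monotone.directed_le fun a b h => KZ.formalRepLE_mono h
  exact (AddSubgroup.mem_iSup_of_directed hdir).1 (KZ.mem_iSup_formalRepLE c)

/-- S⁺ ⇒ crux (routine, as the protocol requires of a strengthening). -/
theorem crux_of_budgetedKernel (h : BudgetedKernel) : XMapKernel := by
  refine crux_of_kernelForm fun c hc => ?_
  obtain ⟨d, hd⟩ := exists_mem_formalRepLE c
  exact KZ.relationsLE_le_relations (d + 1) (h d c hd hc)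

/-! ## §3 Decomposition: the two typed splits in print -/

/-- D1 glue (π-localisation, Ayoub 2014 Cor. 32 shape; closed-term forms of route
AyoubSpecialisation's cruxes): `PiLocalKernel → PiCancellation → XMapKernel`. -/
theorem crux_of_piLocal (h1 : KZ.PiLocalKernel) (h2 : KZ.PiCancellation) : XMapKernel := by
  refine crux_of_kernelForm fun c hc => ?_
  obtain ⟨N, hN⟩ := h1 c hc
  clear hc
  induction N generalizing c with
  | zero => simpa using hN
  | succ N ih =>
    exact h2 c (ih (KZ.of KZ.piRep * c) (by simpa [Function.iterate_succ_apply] using hN))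

/-- … and both pieces are consequences of the crux (so the split is crux ↔ D1a ∧ D1b). -/
theorem piLocal_and_piCancellation_of_crux (h : XMapKernel) : KZ.PiLocalKernel ∧ KZ.PiCancellation :=
  KZ.piLocalKernel_and_piCancellation_of_kernel KZ.relations_le_ker_eval_holds (crux_iff_kernelForm.1 h)

/-- D3: the ℚ-coefficient kernel conjecture (route CoactionDevissage's `RationalKernel`,
VeryGoodTransfer's target shape). -/
def RationalKernel : Prop :=
  ∀ c : KZ.FormalRep, KZ.eval c = 0 → ∃ n : ℕ, 0 < n ∧ n • c ∈ KZ.relations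

/-- D3 glue: with integer division LANDED, the rational kernel gives the crux … -/
theorem crux_of_rationalKernel (h : RationalKernel) : XMapKernel := by
  refine crux_of_kernelForm fun c hc => ?_
  obtain ⟨n, hn, hnc⟩ := h c hc
  exact Summit.KontsevichZagierPeriods.MzvKernelInKZ.Negative.mem_relations_of_nsmul_mem hn hnc

/-- … and conversely (n = 1): the torsion split is DEGENERATE — its hard piece is the crux. -/
theorem rationalKernel_of_crux (h : XMapKernel) : RationalKernel :=
  fun c hc => ⟨1, one_pos, by simpa using (crux_iff_kernelForm.1 h) c hc⟩

theorem rationalKernel_iff_crux : RationalKernel ↔ XMapKernel :=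
  ⟨crux_of_rationalKernel, rationalKernel_of_crux⟩

end Summit.KontsevichZagierPeriods.KontsevichZagierPeriods.Cruxes.XMapKernel.StrategistSketch
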